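import Summits.QuantumFields.YangMills.Theorems.UnitScaleTiltProp7BoxLocalPotentialMember
import Summits.QuantumFields.YangMills.Theorems.UnitScaleTiltProp7LatticeBoxLocalPotential
import Summits.QuantumFields.YangMills.Theorems.UnitScaleTiltProp7LatticeBoxResidualFriedrichs
import HarnessLib

/-!
# Route `UnitScaleTilt`, crux K1 «MinimiserStabilityRegPr» (stmt-QuantumFields-19200), LANE II «DIVERGENCE RECOVERY AT CURVED `W`» (★★OWNER RULING №23), ★p1 g19 NAMER WORD №13 [I-4]
# row `h4` (px12 g7 ■ hand-over «any hand»; ★★OWNER ACK 102 default to w4 g11), part 2∕2: **THE LOCAL COULOMB POTENTIAL OF A BOX PATCH WITH ITS RESIDUAL BOUND** —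
# px12 g7's `Prop7BoxLocalPotentialMember.boxLocalPotential_member` RE-EXPORTED VERBATIM (same ten conjuncts, same construction — copied from HOME `ym3-torus-px12/g7/….px12g7.lean`
# sha16 fe0cbee7497f51fb so that ONE theorem carries the witnesses `φ κs r` with ALL their rows; two ∃-theorems cannot be spliced) PLUS (EL) (B8)'s Euler–Lagrange identity for the
# residual at EVERY box site (px12 exported it on `Q_{R−1}` only, through `κs`; the box Friedrichs inequality needs the boundary sites) PLUS (h4)
# `‖r‖² ≤ 24(2R+1)²·(c₀·CURL_in^F(y_Z)) + 768·d²·R(2R+1)³·α²·N_in(y)` — (B1′) through the chart (part 1∕2 ✓`Prop7LatticeBoxResidualFriedrichs.sum_sq_residual_le`): the box one-form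
# `1_{inside}·r_Z` has divergence functional `|Q_R|·‖m‖² ≤ 64d³R²α²·Σ‖r_Z‖²` by (EL) + (iii′), curl = `curl_V y_Z` minus the holonomy defect `curl_V∇_Vφ_Z`, `φ_Z`-mass `≤ 8R(2R+1)·G(φ)`
# by (iv), `c₀·G(φ)_F ≤ N_in(y)` by (h1); source and curl defects absorbed under the window `832·d³·(2R+1)²R²α² ≤ 1` (`hw4`, displayed next to px12's `hw`).
Cell `ym3-torus`, width seat `ym-ust-19200-w4` (gen 11).  THEOREMS ONLY (0 `def`, 0 `sorry`); `--supports stmt-QuantumFields-19200 --as helper`, count-neutral.  The plaquette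
hypotheses `hP`∕`hw`∕`hw4` stay DISPLAYED on the pull-back `V` (discharge from `RegPr`: `α = 2eη²`, `R = O(L^s·ℓ)` ⇒ `R²α = O(e)` — the member geometry file's).  YM₃ on T³ is a ladder
rung (R3), not d = 4, not the Clay problem; nothing here claims (REC), `hN06`, a stub, the crux or the gap.
References: T. Bałaban, CMP 99 (1985) 389–434 [Balaban1985BackgroundPropagators] ((3.3), (3.8)–(3.10) pp.391–392, (3.23) p.394, (3.100) p.413); CMP 99 (1985) 75–102
[Balaban1985RegularSpaces] ((1.1)–(1.2) p.76); CMP 95 (1984) 17–40 [Balaban1984PropagatorsI] (Prop. 1.1 p.33); M. Giaquinta, *Multiple integrals …* (1983) [Giaquinta1984] (Ch. III §1–§2).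
-/

set_option autoImplicit false

noncomputable section

open scoped BigOperators Matrix.Norms.L2Operator InnerProductSpace Matrix
open Finset

namespace Summit.QuantumFields.YangMills.Theorems.Prop7BoxLocalResidualMember

open Literature.MathematicalPhysics.QuantumFieldTheory.Balaban1983to89
open Literature.MathematicalPhysics.QuantumFieldTheory.Balaban1983to89.T3ContinuumYM3Torus
open Literature.MathematicalPhysics.QuantumFieldTheory.Balaban1983to89.B4Eq19LatticeOperators (Zd box mem_box unitVec box_mono add_unitVec_mem_box sub_unitVec_mem_box)
open B10Eq27TorusAxialLog (transl unitsField toUField unitsField_mem_unitaryUnits)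
open B9TorusCalculus (torusT)
open B9Eq39Adjoint (divB)
open B7Eq78Linearization (conjR conjR_apply)
open B7Prop1Explicit (axialFn)
open B7Prop2Explicit (unitaryUnits)
open T3SectALandauChart (eta eta_pos covDerivFwdT covDivFormT bgUnits)
open B11Eq103H1Complex (SiteL2K BondL2K)
open Summit.QuantumFields.YangMills.Theorems.Prop7SectET3Transport (periodsT3)
open Summit.QuantumFields.YangMills.Theorems.Prop7SectET3HilbertLetters (W₂ frobEquiv toL2 toL2S DL2 DstarL2 covLapSite)
open Summit.QuantumFields.YangMills.Theorems.Prop7LandauDict (DL2_toL2S_eq_covDerivFwdT DstarL2_toL2_eq_covDivFormT)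
open Summit.QuantumFields.YangMills.Theorems.Prop7DivSliceOfMemberDivSq (covDivFormT_eta_eq_smul_divB inv_eta_sq_eq)
open Summit.QuantumFields.YangMills.Theorems.Prop7RieszTauFrobNorm (norm_sq_frobEquiv_symm sum_norm_sq_le_two_mul_opNorm_sq)
open Summit.QuantumFields.YangMills.Theorems.Prop7LatticeBoxPotentialAlgebra (re_trace_conjR_conjR)
open Summit.QuantumFields.YangMills.Theorems.Prop7LatticeBoxLocalPotential (boxLocalPotential_trace)
open Summit.QuantumFields.YangMills.Theorems.PoincareLipschitzCovariantBridge (transl_add_unitVec transl_sub_unitVec)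
open Summit.QuantumFields.YangMills.Theorems.Prop7BoxChartTransport
open Summit.QuantumFields.YangMills.Theorems.Prop7BoxLocalPotentialMember (conjR_real_smul DL2_toL2S_eta_smul_apply DstarL2_toL2_apply_transl sum_norm_sq_real_smul)
open B7Prop1Explicit (U1)
open B8Ineq132 (norm_conjR)
open Summit.QuantumFields.YangMills.Theorems.Prop7LatticeBoxPotentialAlgebra (mem_U1_of_mem_unitaryUnits)
open Summit.QuantumFields.YangMills.Theorems.Prop7LatticeBoxResidualFriedrichs (sum_sq_residual_le)

variable (F : T3Family) (n K : ℕ) (c₀ : ℝ) [Fact (0 < c₀)]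


/-! ## §1 The residual row in Frobenius currency (generic box one-form, `N = 2`) -/

/-- ★★ **THE RESIDUAL ROW IN FROBENIUS CURRENCY, FROM (B8)'s ROWS** (`N = 2`, any dimension `d`, any box one-form `y_Z`): if `φ_Z`, `m` satisfy (B8)'s Euler–Lagrange identity
(ii) at every box site, the source bound (iii′), Pythagoras (i′) and the box Poincaré row (iv) of ✓`Prop7LatticeBoxLocalPotential.boxLocalPotential_trace` (texts VERBATIM at `N = 2`),
and the window `832·d³·(2R+1)²R²α² ≤ 1` holds, then for every `c₀ ≥ 0`
`c₀·Σ_{inside}‖y_Z − ∇_Vφ_Z‖_F² ≤ 24(2R+1)²·(c₀·Σ_{Q_R}Σ_μΣ_ν[x+e_μ+e_ν ∈ Q_R]‖curl_V y_Z‖_F²) + 768·d²·R(2R+1)³·α²·(c₀·Σ_{inside}‖y_Z‖_F²)` — part 1∕2's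
✓`sum_sq_residual_le` for the box one-form `1_{inside}·(y_Z − ∇_Vφ_Z)` (divergence functional `= |Q_R|·‖m‖² ≤ 64d³R²α²·Σ‖·‖²`, `π₀ = 8R(2R+1)`), operator norms within a factor `2` of Frobenius.
[cite: Balaban1985BackgroundPropagators, (3.23) p.394, (3.8)-(3.10) p.392; Balaban1984PropagatorsI, Prop. 1.1 p.33] -/
theorem residual_row_frobenius {d : ℕ} {z : Zd d} {R : ℤ} (hR : 0 ≤ R) {α : ℝ} (hα : 0 ≤ α)
    (V : Zd d → Fin d → (Matrix (Fin 2) (Fin 2) ℂ)ˣ) (hVu : ∀ w μ, V w μ ∈ unitaryUnits (Matrix (Fin 2) (Fin 2) ℂ))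
    (hP : B8Lemma1NonAbelian.PlaqSmall V (fun i => z i - R) (fun i => z i + R) α)
    (hw4 : 832 * (d : ℝ) ^ 3 * (2 * R + 1) ^ 2 * R ^ 2 * α ^ 2 ≤ 1) {c₀ : ℝ} (hc₀ : 0 ≤ c₀)
    (yZ : Zd d → Fin d → Matrix (Fin 2) (Fin 2) ℂ) (φZ : Zd d → Matrix (Fin 2) (Fin 2) ℂ) (m : Matrix (Fin 2) (Fin 2) ℂ)
    (hEL : ∀ x ∈ box z R,
        ∑ μ, ((if x - unitVec μ ∈ box z R then
                conjR (V (x - unitVec μ) μ)⁻¹ (yZ (x - unitVec μ) μ - (conjR (V (x - unitVec μ) μ) (φZ x) - φZ (x - unitVec μ))) else 0)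
              - (if x + unitVec μ ∈ box z R then (yZ x μ - (conjR (V x μ) (φZ (x + unitVec μ)) - φZ x)) else 0))
          = conjR (axialFn V (fun i => z i - R) x)⁻¹ m)
    (hSrc : ((box z R).card : ℝ) * (Matrix.trace (mᴴ * m)).re
        ≤ 16 * (d : ℝ) ^ 3 * ((2 : ℕ) : ℝ) * R ^ 2 * α ^ 2 *
            ∑ x ∈ box z R, ∑ μ, (if x + unitVec μ ∈ box z R then
              (Matrix.trace ((yZ x μ - (conjR (V x μ) (φZ (x + unitVec μ)) - φZ x))ᴴ * (yZ x μ - (conjR (V x μ) (φZ (x + unitVec μ)) - φZ x)))).re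
            else 0))
    (hPyth : ∑ x ∈ box z R, ∑ μ, (if x + unitVec μ ∈ box z R then (Matrix.trace ((yZ x μ)ᴴ * yZ x μ)).re else 0)
        = ∑ x ∈ box z R, ∑ μ, (if x + unitVec μ ∈ box z R then
              (Matrix.trace ((conjR (V x μ) (φZ (x + unitVec μ)) - φZ x)ᴴ * (conjR (V x μ) (φZ (x + unitVec μ)) - φZ x))).re else 0)
          + ∑ x ∈ box z R, ∑ μ, (if x + unitVec μ ∈ box z R then
              (Matrix.trace ((yZ x μ - (conjR (V x μ) (φZ (x + unitVec μ)) - φZ x))ᴴ * (yZ x μ - (conjR (V x μ) (φZ (x + unitVec μ)) - φZ x)))).re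
            else 0))
    (hPoinc : ∑ x ∈ box z R, ‖φZ x‖ ^ 2
        ≤ 4 * ((2 : ℕ) : ℝ) * R * (2 * R + 1) *
            ∑ x ∈ box z R, ∑ μ, (if x + unitVec μ ∈ box z R then ‖conjR (V x μ) (φZ (x + unitVec μ)) - φZ x‖ ^ 2 else 0)) :
    c₀ * ∑ w ∈ box z R, ∑ μ, (if w + unitVec μ ∈ box z R then
        ∑ j : Fin 2, ∑ k : Fin 2, ‖(yZ w μ - (conjR (V w μ) (φZ (w + unitVec μ)) - φZ w)) j k‖ ^ 2 else 0)
      ≤ 24 * (2 * (R : ℝ) + 1) ^ 2 *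
            (c₀ * ∑ w ∈ box z R, ∑ μ, ∑ ν, (if w + unitVec μ + unitVec ν ∈ box z R then
              ∑ j : Fin 2, ∑ k : Fin 2, ‖(yZ w μ + conjR (V w μ) (yZ (w + unitVec μ) ν) - conjR (V w ν) (yZ (w + unitVec ν) μ) - yZ w ν) j k‖ ^ 2 else 0))
        + 768 * (d : ℝ) ^ 2 * R * (2 * R + 1) ^ 3 * α ^ 2 *
            (c₀ * ∑ w ∈ box z R, ∑ μ, (if w + unitVec μ ∈ box z R then ∑ j : Fin 2, ∑ k : Fin 2, ‖(yZ w μ) j k‖ ^ 2 else 0)) := by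
  classical
  have hu : ∀ w, axialFn V (fun i => z i - R) w ∈ unitaryUnits (Matrix (Fin 2) (Fin 2) ℂ) := fun w => B7Prop2Explicit.hol_mem_of hVu _ _
  have hV1 : ∀ w μ, V w μ ∈ U1 (Matrix (Fin 2) (Fin 2) ℂ) := fun w μ => mem_U1_of_mem_unitaryUnits (hVu w μ)
  have hu1i : ∀ w, (axialFn V (fun i => z i - R) w)⁻¹ ∈ U1 (Matrix (Fin 2) (Fin 2) ℂ) :=
    fun w => mem_U1_of_mem_unitaryUnits ((unitaryUnits _).inv_mem (hu w))
  have hR0 : (0 : ℝ) ≤ R := by exact_mod_cast hR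
  -- the box one-form
  set g : Zd d → Fin d → Matrix (Fin 2) (Fin 2) ℂ := fun w μ =>
    if w ∈ box z R ∧ w + unitVec μ ∈ box z R then
      yZ w μ - (conjR (V w μ) (φZ (w + unitVec μ)) - φZ w) else 0 with hg
  have hg0 : ∀ (x : Zd d) (μ : Fin d), (x ∉ box z R ∨ x + unitVec μ ∉ box z R) → g x μ = 0 := by
    intro x μ hx
    have hn : ¬ (x ∈ box z R ∧ x + unitVec μ ∈ box z R) := by tauto
    simp only [hg, if_neg hn]
  have hg1 : ∀ x ∈ box z R, ∀ μ, x + unitVec μ ∈ box z R →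
      g x μ = yZ x μ - (conjR (V x μ) (φZ (x + unitVec μ)) - φZ x) := by
    intro x hx μ hxμ
    simp only [hg, if_pos (And.intro hx hxμ)] -- Frobenius of the residual over the inside edges is within a factor 2 of the operator-norm box sum of `g`
  have hRF : ∑ w ∈ box z R, ∑ μ, (if w + unitVec μ ∈ box z R then ∑ j : Fin 2, ∑ k : Fin 2, ‖(yZ w μ - (conjR (V w μ) (φZ (w + unitVec μ)) - φZ w)) j k‖ ^ 2 else 0) ≤ 2 * ∑ w ∈ box z R, ∑ μ, ‖g w μ‖ ^ 2 := by
    rw [Finset.mul_sum]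
    refine Finset.sum_le_sum fun w hw => ?_
    rw [Finset.mul_sum]
    refine Finset.sum_le_sum fun μ _ => ?_
    split_ifs with hwμ
    · rw [hg1 w hw μ hwμ]; exact sum_norm_sq_le_two_mul_opNorm_sq _
    · positivity -- the divergence functional of `g` is the axial-constant source, at EVERY box site
  have hdivpt : ∀ x ∈ box z R, ∑ μ, (conjR (V (x - unitVec μ) μ)⁻¹ (g (x - unitVec μ) μ) - g x μ) = conjR (axialFn V (fun i => z i - R) x)⁻¹ m := by
    intro x hx
    rw [← hEL x hx]
    refine Finset.sum_congr rfl fun μ _ => ?_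
    have e1 : g (x - unitVec μ) μ = if x - unitVec μ ∈ box z R then
        yZ (x - unitVec μ) μ - (conjR (V (x - unitVec μ) μ) (φZ x) - φZ (x - unitVec μ)) else 0 := by
      by_cases h1 : x - unitVec μ ∈ box z R
      · rw [if_pos h1, hg1 _ h1 μ (by rw [sub_add_cancel]; exact hx), sub_add_cancel]
      · rw [if_neg h1, hg0 _ μ (Or.inl h1)]
    have e2 : g x μ = if x + unitVec μ ∈ box z R then (yZ x μ - (conjR (V x μ) (φZ (x + unitVec μ)) - φZ x)) else 0 := by
      by_cases h2 : x + unitVec μ ∈ box z R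
      · rw [if_pos h2, hg1 x hx μ h2]
      · rw [if_neg h2, hg0 x μ (Or.inr h2)]
    rw [e1, e2]
    congr 1
    split_ifs with h1
    · rfl
    · simp only [conjR_apply, mul_zero, zero_mul]
  have hDIV : ∑ x ∈ box z R, ‖∑ μ, (conjR (V (x - unitVec μ) μ)⁻¹ (g (x - unitVec μ) μ) - g x μ)‖ ^ 2 ≤ (64 * (d : ℝ) ^ 3 * R ^ 2 * α ^ 2) * ∑ x ∈ box z R, ∑ μ, ‖g x μ‖ ^ 2 := by
    have hdiv : ∑ x ∈ box z R, ‖∑ μ, (conjR (V (x - unitVec μ) μ)⁻¹ (g (x - unitVec μ) μ) - g x μ)‖ ^ 2 = ((box z R).card : ℝ) * ‖m‖ ^ 2 := by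
      rw [Finset.sum_congr rfl fun x hx => by rw [hdivpt x hx, norm_conjR (hu1i x)], Finset.sum_const, nsmul_eq_mul]
    have hmF : ‖m‖ ^ 2 ≤ ∑ j : Fin 2, ∑ k : Fin 2, ‖m j k‖ ^ 2 := MatrixNorms.opNorm_sq_le_sum_norm_sq _
    have hS := hSrc
    simp_rw [← MatrixNorms.sum_norm_sq_eq_re_trace] at hS
    push_cast at hS
    have hcard : (0 : ℝ) ≤ ((box z R).card : ℝ) := Nat.cast_nonneg _
    have hk : 0 ≤ 16 * (d : ℝ) ^ 3 * 2 * R ^ 2 * α ^ 2 := by positivity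
    rw [hdiv]
    calc ((box z R).card : ℝ) * ‖m‖ ^ 2 ≤ ((box z R).card : ℝ) * ∑ j : Fin 2, ∑ k : Fin 2, ‖m j k‖ ^ 2 := mul_le_mul_of_nonneg_left hmF hcard
      _ ≤ 16 * (d : ℝ) ^ 3 * 2 * R ^ 2 * α ^ 2 * ∑ x ∈ box z R, ∑ μ, (if x + unitVec μ ∈ box z R then ∑ j : Fin 2, ∑ k : Fin 2, ‖((yZ x μ - (conjR (V x μ) (φZ (x + unitVec μ)) - φZ x))) j k‖ ^ 2 else 0) := hS
      _ ≤ 16 * (d : ℝ) ^ 3 * 2 * R ^ 2 * α ^ 2 * (2 * ∑ w ∈ box z R, ∑ μ, ‖g w μ‖ ^ 2) := mul_le_mul_of_nonneg_left hRF hk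
      _ = (64 * (d : ℝ) ^ 3 * R ^ 2 * α ^ 2) * ∑ x ∈ box z R, ∑ μ, ‖g x μ‖ ^ 2 := by ring -- the box Poincaré row for `φ_Z` (operator norms)
  have hΦ : ∑ x ∈ box z R, ‖φZ x‖ ^ 2 ≤ (4 * 2 * R * (2 * R + 1)) * ∑ x ∈ box z R, ∑ μ, (if x + unitVec μ ∈ box z R then ‖conjR (V x μ) (φZ (x + unitVec μ)) - φZ x‖ ^ 2 else 0) := by
    have h := hPoinc; push_cast at h; exact h -- the window
  have hwin : 2 * ((2 : ℕ) : ℝ) * (2 * (R : ℝ) + 1) ^ 2 * (64 * (d : ℝ) ^ 3 * R ^ 2 * α ^ 2) + 80 * (d : ℝ) ^ 3 * ((2 : ℕ) : ℝ) * (2 * (R : ℝ) + 1) ^ 2 * R ^ 2 * α ^ 2 ≤ 1 / 2 := by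
    have e : 2 * ((2 : ℕ) : ℝ) * (2 * (R : ℝ) + 1) ^ 2 * (64 * (d : ℝ) ^ 3 * R ^ 2 * α ^ 2) + 80 * (d : ℝ) ^ 3 * ((2 : ℕ) : ℝ) * (2 * (R : ℝ) + 1) ^ 2 * R ^ 2 * α ^ 2
        = (832 * (d : ℝ) ^ 3 * (2 * R + 1) ^ 2 * R ^ 2 * α ^ 2) / 2 := by push_cast; ring
    rw [e]; linarith -- (B1′) for the residual (part 1∕2)
  have hres := sum_sq_residual_le (N := 2) hR hα V hV1 hP yZ φZ g hg0 hg1 hDIV hΦ hwin -- operator norm ≤ Frobenius on the curl and gradient functionals; Pythagoras bounds the gradient energy by `N_in(y)`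
  have hCF : ∑ w ∈ box z R, ∑ μ, ∑ ν, (if w + unitVec μ + unitVec ν ∈ box z R then ‖yZ w μ + conjR (V w μ) (yZ (w + unitVec μ) ν) - conjR (V w ν) (yZ (w + unitVec ν) μ) - yZ w ν‖ ^ 2 else 0)
      ≤ ∑ w ∈ box z R, ∑ μ, ∑ ν, (if w + unitVec μ + unitVec ν ∈ box z R then ∑ j : Fin 2, ∑ k : Fin 2, ‖(yZ w μ + conjR (V w μ) (yZ (w + unitVec μ) ν) - conjR (V w ν) (yZ (w + unitVec ν) μ) - yZ w ν) j k‖ ^ 2 else 0) := by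
    refine Finset.sum_le_sum fun w _ => Finset.sum_le_sum fun μ _ => Finset.sum_le_sum fun ν _ => ?_
    split_ifs
    · exact MatrixNorms.opNorm_sq_le_sum_norm_sq _
    · exact le_rfl
  have hGF : ∑ x ∈ box z R, ∑ μ, (if x + unitVec μ ∈ box z R then ‖conjR (V x μ) (φZ (x + unitVec μ)) - φZ x‖ ^ 2 else 0) ≤ ∑ x ∈ box z R, ∑ μ, (if x + unitVec μ ∈ box z R then
          ∑ j : Fin 2, ∑ k : Fin 2, ‖(conjR (V x μ) (φZ (x + unitVec μ)) - φZ x) j k‖ ^ 2 else 0) := by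
    refine Finset.sum_le_sum fun w _ => Finset.sum_le_sum fun μ _ => ?_
    split_ifs
    · exact MatrixNorms.opNorm_sq_le_sum_norm_sq _
    · exact le_rfl
  have hPy : ∑ x ∈ box z R, ∑ μ, (if x + unitVec μ ∈ box z R then ∑ j : Fin 2, ∑ k : Fin 2, ‖(conjR (V x μ) (φZ (x + unitVec μ)) - φZ x) j k‖ ^ 2 else 0) ≤ ∑ x ∈ box z R, ∑ μ, (if x + unitVec μ ∈ box z R then
          ∑ j : Fin 2, ∑ k : Fin 2, ‖(yZ x μ) j k‖ ^ 2 else 0) := by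
    have hP' := hPyth
    simp_rw [← MatrixNorms.sum_norm_sq_eq_re_trace] at hP'
    rw [hP']
    have h0 : 0 ≤ ∑ x ∈ box z R, ∑ μ, (if x + unitVec μ ∈ box z R then ∑ j : Fin 2, ∑ k : Fin 2, ‖((yZ x μ - (conjR (V x μ) (φZ (x + unitVec μ)) - φZ x))) j k‖ ^ 2 else 0) := by
      refine Finset.sum_nonneg fun x _ => Finset.sum_nonneg fun μ _ => ?_
      split_ifs <;> positivity
    linarith -- assemble
  have hG0 : 0 ≤ ∑ w ∈ box z R, ∑ μ, ‖g w μ‖ ^ 2 := by positivity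
  have hA : 0 ≤ 6 * ((2 : ℕ) : ℝ) * (2 * (R : ℝ) + 1) ^ 2 := by positivity
  have hB : 0 ≤ 24 * ((2 : ℕ) : ℝ) * (2 * (R : ℝ) + 1) ^ 2 * (d : ℝ) ^ 2 * (4 * 2 * R * (2 * R + 1)) * α ^ 2 := by positivity
  have h1 := mul_le_mul_of_nonneg_left hCF hA
  have h2 := mul_le_mul_of_nonneg_left (hGF.trans hPy) hB
  have h3 : ∑ w ∈ box z R, ∑ μ, ‖g w μ‖ ^ 2 ≤ 6 * ((2 : ℕ) : ℝ) * (2 * (R : ℝ) + 1) ^ 2 * ∑ w ∈ box z R, ∑ μ, ∑ ν, (if w + unitVec μ + unitVec ν ∈ box z R then ∑ j : Fin 2, ∑ k : Fin 2, ‖(yZ w μ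
              + conjR (V w μ) (yZ (w + unitVec μ) ν) - conjR (V w ν) (yZ (w + unitVec ν) μ) - yZ w ν) j k‖ ^ 2 else 0) + 24 * ((2 : ℕ) : ℝ) * (2 * (R : ℝ) + 1) ^ 2 * (d : ℝ) ^ 2 * (4 * 2 * R * (2 * R + 1)) * α ^ 2 *
          ∑ x ∈ box z R, ∑ μ, (if x + unitVec μ ∈ box z R then ∑ j : Fin 2, ∑ k : Fin 2, ‖(yZ x μ) j k‖ ^ 2 else 0) := by
    exact hres.trans (add_le_add h1 h2)
  have h4 := mul_le_mul_of_nonneg_left (hRF.trans (mul_le_mul_of_nonneg_left h3 (by norm_num : (0:ℝ) ≤ 2))) hc₀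
  have key : ∀ CF NF : ℝ,
      c₀ * (2 * (6 * ((2 : ℕ) : ℝ) * (2 * (R : ℝ) + 1) ^ 2 * CF + 24 * ((2 : ℕ) : ℝ) * (2 * (R : ℝ) + 1) ^ 2 * (d : ℝ) ^ 2 * (4 * 2 * R * (2 * R + 1)) * α ^ 2 * NF))
        = 24 * (2 * (R : ℝ) + 1) ^ 2 * (c₀ * CF) + 768 * (d : ℝ) ^ 2 * R * (2 * R + 1) ^ 3 * α ^ 2 * (c₀ * NF) := by
    intro CF NF; push_cast; ring
  exact h4.trans (le_of_eq (key _ _))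


/-! ## §2 The local Coulomb potential of a box patch at the member, with the Euler–Lagrange identity at every box site and the residual row (h4) -/

/-- ★★★ **(B8-member)⁺ — THE LOCAL COULOMB POTENTIAL OF A BOX PATCH AT THE MEMBER, WITH (EL) AT EVERY BOX SITE AND THE RESIDUAL ROW (h4)** (★p1 g19 NAMER WORD №13 [I-4]).
Binders and the first TEN conjuncts (S1a)(S1b)(S2a)(S2b)(D)(hloc)(L1)(h1)(h2)(h3) = px12 g7's `Prop7BoxLocalPotentialMember.boxLocalPotential_member` VERBATIM (one extra window `hw4`);
then (EL) `Σ_μ ([w−e_μ ∈ Q_R]·R(V(w−e_μ) μ)⁻¹ r_Z(w−e_μ) μ − [w+e_μ ∈ Q_R]·r_Z w μ) = R(u w)⁻¹ m` for EVERY `w ∈ Q_R(z)` (`r_Z := y_Z − ∇_Vφ_Z`, `y_Z w μ := (toL2)⁻¹ y ⟨transl c w, μ⟩`,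
`u` = the box axial gauge), and (h4) `‖r‖² ≤ 24(2R+1)²·(c₀·Σ_{w∈Q_R}Σ_μΣ_ν [w+e_μ+e_ν ∈ Q_R]·‖curl_V y_Z (w,μ,ν)‖_F²) + 768·d²·R(2R+1)³·α²·(c₀·Σ_{inside}‖y_Z‖_F²)`
(curl token of (B1′): `y_Z w μ + R(V w μ)y_Z(w+e_μ) ν − R(V w ν)y_Z(w+e_ν) μ − y_Z w ν`, all ordered pairs; `‖·‖_F² = Σ_jk‖· j k‖²`),
and last (0) the (B8) NORMALISATION `Σ_{w∈Q_R} R(u w)(φ_Z w) = 0` of the SAME `φ_Z` (✓`boxLocalPotential_trace`'s first conjunct, kept — the (B9d) consumer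
`Prop7LatticeTiledCube.norm_sum_axial_sq_le_of_normalised` ∕ px9's (a′)-2 knit needs it on this witness).
[cite: Balaban1985BackgroundPropagators, (3.23) p.394, (3.8)-(3.10) p.392, (3.100) p.413; Balaban1984PropagatorsI, Prop. 1.1 p.33; Balaban1985RegularSpaces, (1.1)-(1.2) p.76; Giaquinta1984, Ch. III §2] -/
theorem boxLocalResidual_member (W : GaugeField (F.P K) 0 (Matrix.specialUnitaryGroup (Fin 2) ℂ))
    (c : Site (F.P K) 0) {z : Zd (F.P K).d} {R : ℤ} (hR : 0 ≤ R) (hRN : 2 * R + 1 ≤ ((F.P K).sitesPerDir 0 : ℤ))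
    (V : Zd (F.P K).d → Fin (F.P K).d → (Matrix (Fin 2) (Fin 2) ℂ)ˣ) (hV : ∀ w μ, V w μ = unitsField (toUField W) ⟨transl c w, μ⟩)
    {α : ℝ} (hα : 0 ≤ α) (hP : B8Lemma1NonAbelian.PlaqSmall V (fun i => z i - R) (fun i => z i + R) α)
    (hw : 64 * ((F.P K).d : ℝ) ^ 3 * 2 * R ^ 3 * (2 * R + 1) * α ^ 2 ≤ 1)
    (hw4 : 832 * ((F.P K).d : ℝ) ^ 3 * (2 * R + 1) ^ 2 * R ^ 2 * α ^ 2 ≤ 1)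
    (y : BondL2K ℂ 3 (periodsT3 F K) c₀ W₂) :
    ∃ (φ κs : SiteL2K ℂ 3 (periodsT3 F K) c₀ W₂) (r : BondL2K ℂ 3 (periodsT3 F K) c₀ W₂)
      (φZ : Zd (F.P K).d → Matrix (Fin 2) (Fin 2) ℂ) (m : Matrix (Fin 2) (Fin 2) ℂ),
      (∀ x, (∀ w ∈ box z R, transl c w ≠ x) → (toL2S F K c₀).symm φ x = 0) ∧
      (∀ w ∈ box z R, (toL2S F K c₀).symm φ (transl c w) = (eta F n K) • φZ w) ∧
      (∀ b : PBond (F.P K) 0, (∀ w ∈ box z R, transl c w ≠ b.src) → (toL2 F K c₀).symm r b = 0) ∧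
      (∀ w ∈ box z R, ∀ μ, (toL2 F K c₀).symm r ⟨transl c w, μ⟩
          = if w + unitVec μ ∈ box z R then (toL2 F K c₀).symm y ⟨transl c w, μ⟩ - (conjR (V w μ) (φZ (w + unitVec μ)) - φZ w) else 0) ∧
      (∀ w ∈ box z R, ∀ μ, w + unitVec μ ∈ box z R →
          (toL2 F K c₀).symm (DL2 F n K c₀ W φ) ⟨transl c w, μ⟩ = conjR (V w μ) (φZ (w + unitVec μ)) - φZ w) ∧
      (DstarL2 F n K c₀ W y = covLapSite F n K c₀ W φ + κs) ∧
      (∀ w ∈ box z (R - 1), (toL2S F K c₀).symm κs (transl c w) = (eta F n K)⁻¹ • conjR (axialFn V (fun i => z i - R) w)⁻¹ m) ∧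
      (c₀ * ∑ w ∈ box z R, ∑ μ, (if w + unitVec μ ∈ box z R then ∑ j : Fin 2, ∑ k : Fin 2, ‖((toL2 F K c₀).symm y ⟨transl c w, μ⟩) j k‖ ^ 2 else 0)
        = c₀ * ∑ w ∈ box z R, ∑ μ, (if w + unitVec μ ∈ box z R then
              ∑ j : Fin 2, ∑ k : Fin 2, ‖(conjR (V w μ) (φZ (w + unitVec μ)) - φZ w) j k‖ ^ 2 else 0)
          + ‖r‖ ^ 2) ∧
      (‖φ‖ ^ 2 ≤ 16 * R * (2 * R + 1) * (eta F n K) ^ 2 *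
          (c₀ * ∑ w ∈ box z R, ∑ μ, (if w + unitVec μ ∈ box z R then
              ∑ j : Fin 2, ∑ k : Fin 2, ‖(conjR (V w μ) (φZ (w + unitVec μ)) - φZ w) j k‖ ^ 2 else 0))) ∧
      (c₀ * ∑ w ∈ box z (R - 1), ∑ j : Fin 2, ∑ k : Fin 2, ‖((eta F n K)⁻¹ • conjR (axialFn V (fun i => z i - R) w)⁻¹ m) j k‖ ^ 2
        ≤ 16 * ((F.P K).d : ℝ) ^ 3 * 2 * R ^ 2 * α ^ 2 * ((eta F n K)⁻¹) ^ 2 * ‖r‖ ^ 2) ∧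
      (∀ w ∈ box z R,
        ∑ μ, ((if w - unitVec μ ∈ box z R then
                conjR (V (w - unitVec μ) μ)⁻¹ ((toL2 F K c₀).symm y ⟨transl c (w - unitVec μ), μ⟩
                  - (conjR (V (w - unitVec μ) μ) (φZ w) - φZ (w - unitVec μ))) else 0)
              - (if w + unitVec μ ∈ box z R then ((toL2 F K c₀).symm y ⟨transl c w, μ⟩ - (conjR (V w μ) (φZ (w + unitVec μ)) - φZ w)) else 0))
          = conjR (axialFn V (fun i => z i - R) w)⁻¹ m) ∧
      (‖r‖ ^ 2 ≤ 24 * (2 * (R : ℝ) + 1) ^ 2 *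
            (c₀ * ∑ w ∈ box z R, ∑ μ, ∑ ν, (if w + unitVec μ + unitVec ν ∈ box z R then
              ∑ j : Fin 2, ∑ k : Fin 2, ‖((toL2 F K c₀).symm y ⟨transl c w, μ⟩
                + conjR (V w μ) ((toL2 F K c₀).symm y ⟨transl c (w + unitVec μ), ν⟩)
                - conjR (V w ν) ((toL2 F K c₀).symm y ⟨transl c (w + unitVec ν), μ⟩)
                - (toL2 F K c₀).symm y ⟨transl c w, ν⟩) j k‖ ^ 2 else 0))
          + 768 * ((F.P K).d : ℝ) ^ 2 * R * (2 * R + 1) ^ 3 * α ^ 2 *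
            (c₀ * ∑ w ∈ box z R, ∑ μ, (if w + unitVec μ ∈ box z R then
              ∑ j : Fin 2, ∑ k : Fin 2, ‖((toL2 F K c₀).symm y ⟨transl c w, μ⟩) j k‖ ^ 2 else 0))) ∧
      (∑ w ∈ box z R, conjR (axialFn V (fun i => z i - R) w) (φZ w) = 0) := by
  classical
  have hη : 0 < eta F n K := eta_pos F n K
  have hc₀ : 0 < c₀ := Fact.out
  -- the pull-back connection is unitary
  have hVu : ∀ w μ, V w μ ∈ unitaryUnits (Matrix (Fin 2) (Fin 2) ℂ) := fun w μ => by
    rw [hV]; exact unitsField_mem_unitaryUnits (toUField W) _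
  have hu : ∀ w, axialFn V (fun i => z i - R) w ∈ unitaryUnits (Matrix (Fin 2) (Fin 2) ℂ) := fun w => B7Prop2Explicit.hol_mem_of hVu _ _
  -- the one-form read as a bond field, and (B8) on the box for its pull-back
  have hyY : y = toL2 F K c₀ ((toL2 F K c₀).symm y) := (LinearEquiv.apply_symm_apply _ _).symm
  have hw' : 64 * ((F.P K).d : ℝ) ^ 3 * (2 : ℕ) * R ^ 3 * (2 * R + 1) * α ^ 2 ≤ 1 := by push_cast; exact hw
  obtain ⟨φZ, m, h0, hPyth, hEL, hSrc, hPoinc⟩ := boxLocalPotential_trace hR hα V hVu hP hw' (fun w μ => (toL2 F K c₀).symm y ⟨transl c w, μ⟩)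
  -- push-forwards along the chart
  obtain ⟨Φs, hΦs, hΦs0⟩ := exists_site_pushforward c hRN φZ
  obtain ⟨Xr, hXr, hXr0⟩ := exists_bond_pushforward c hRN
    (fun w μ => if w + unitVec μ ∈ box z R then (toL2 F K c₀).symm y ⟨transl c w, μ⟩ - (conjR (V w μ) (φZ (w + unitVec μ)) - φZ w) else 0)
  -- (D): the gradient of `φ := toL2S (η • Φs)` on the inside chart bonds
  have hD : ∀ w ∈ box z R, ∀ μ, w + unitVec μ ∈ box z R →
      (toL2 F K c₀).symm (DL2 F n K c₀ W (toL2S F K c₀ ((eta F n K) • Φs))) ⟨transl c w, μ⟩ = conjR (V w μ) (φZ (w + unitVec μ)) - φZ w := by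
    intro w hw μ hwμ
    rw [DL2_toL2S_eta_smul_apply]
    show conjR (unitsField (toUField W) ⟨transl c w, μ⟩) (Φs ((transl c w).shift μ)) - Φs (transl c w) = _
    rw [← transl_add_unitVec, hΦs _ hwμ, hΦs w hw, hV]
  -- the norm of `r := toL2 Xr`
  have hr : ‖toL2 F K c₀ Xr‖ ^ 2 = c₀ * ∑ w ∈ box z R, ∑ μ, (if w + unitVec μ ∈ box z R then
      ∑ j : Fin 2, ∑ k : Fin 2, ‖((toL2 F K c₀).symm y ⟨transl c w, μ⟩ - (conjR (V w μ) (φZ (w + unitVec μ)) - φZ w)) j k‖ ^ 2 else 0) := by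
    rw [norm_toL2_sq_eq_sum_box F K c₀ c hRN Xr hXr0]
    refine congrArg (fun t : ℝ => c₀ * t) (Finset.sum_congr rfl fun w hw => Finset.sum_congr rfl fun μ _ => ?_)
    rw [hXr w hw μ]
    split_ifs with hif
    · rfl
    · simp
  refine ⟨toL2S F K c₀ ((eta F n K) • Φs),
    DstarL2 F n K c₀ W y - covLapSite F n K c₀ W (toL2S F K c₀ ((eta F n K) • Φs)),
    toL2 F K c₀ Xr, φZ, m, ?_, ?_, ?_, ?_, hD, ?_, ?_, ?_, ?_, ?_, hEL, ?_, h0⟩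
  -- (S1a)
  · intro x hx
    rw [LinearEquiv.symm_apply_apply, Pi.smul_apply, hΦs0 x hx, smul_zero]
  -- (S1b)
  · intro w hw
    rw [LinearEquiv.symm_apply_apply, Pi.smul_apply, hΦs w hw]
  -- (S2a)
  · intro b hb
    rw [LinearEquiv.symm_apply_apply]
    exact hXr0 b hb
  -- (S2b)
  · intro w hw μ
    rw [LinearEquiv.symm_apply_apply]
    exact hXr w hw μ
  -- (hloc)
  · abel
  -- (L1)
  · intro w hw1
    have hwR : w ∈ box z R := box_mono z (by linarith) hw1
    have hwm : ∀ μ, w - unitVec μ ∈ box z R := fun μ => by simpa using sub_unitVec_mem_box hw1 μ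
    have hwp : ∀ μ, w + unitVec μ ∈ box z R := fun μ => by simpa using add_unitVec_mem_box hw1 μ
    -- `κs = D*_W (y − D_Wφ)` read at the chart site
    have hG : DL2 F n K c₀ W (toL2S F K c₀ ((eta F n K) • Φs))
        = toL2 F K c₀ ((toL2 F K c₀).symm (DL2 F n K c₀ W (toL2S F K c₀ ((eta F n K) • Φs)))) := by
      rw [LinearEquiv.apply_symm_apply]
    have hΔ : covLapSite F n K c₀ W (toL2S F K c₀ ((eta F n K) • Φs))
        = DstarL2 F n K c₀ W (DL2 F n K c₀ W (toL2S F K c₀ ((eta F n K) • Φs))) := rfl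
    rw [hΔ, ← LinearMap.map_sub, hG]
    conv_lhs => rw [hyY]
    rw [← map_sub, DstarL2_toL2_apply_transl]
    refine congrArg (fun M : Matrix (Fin 2) (Fin 2) ℂ => (eta F n K)⁻¹ • M) ?_
    rw [← hEL w hwR]
    refine Finset.sum_congr rfl fun μ _ => ?_
    rw [if_pos (hwm μ), if_pos (hwp μ)]
    try simp only [Pi.sub_apply]
    rw [hD (w - unitVec μ) (hwm μ) μ (by rw [sub_add_cancel]; exact hwR), hD w hwR μ (hwp μ), sub_add_cancel, ← hV]
  -- (h1) Pythagoras
  · have hP' := hPyth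
    simp_rw [← MatrixNorms.sum_norm_sq_eq_re_trace] at hP'
    rw [hr, ← mul_add, hP']
  -- (h2) Poincaré
  · have hφn : ‖toL2S F K c₀ ((eta F n K) • Φs)‖ ^ 2 = c₀ * ∑ w ∈ box z R, ∑ j : Fin 2, ∑ k : Fin 2, ‖((eta F n K) • φZ w) j k‖ ^ 2 := by
      rw [norm_sq_toL2S_eq_sum_box F K c₀ c hRN ((eta F n K) • Φs) (fun x hx => by rw [Pi.smul_apply, hΦs0 x hx, smul_zero])]
      exact congrArg (fun t : ℝ => c₀ * t) (Finset.sum_congr rfl fun w hw => by rw [Pi.smul_apply, hΦs w hw])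
    rw [hφn]
    simp_rw [sum_norm_sq_real_smul]
    have hPo : ∑ x ∈ box z R, ‖φZ x‖ ^ 2 ≤ 4 * 2 * R * (2 * R + 1) *
        ∑ x ∈ box z R, ∑ μ, (if x + unitVec μ ∈ box z R then ‖conjR (V x μ) (φZ (x + unitVec μ)) - φZ x‖ ^ 2 else 0) := by
      have h := hPoinc; push_cast at h; exact h
    have hOF : ∑ x ∈ box z R, ∑ μ, (if x + unitVec μ ∈ box z R then ‖conjR (V x μ) (φZ (x + unitVec μ)) - φZ x‖ ^ 2 else 0)
        ≤ ∑ x ∈ box z R, ∑ μ, (if x + unitVec μ ∈ box z R then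
            ∑ j : Fin 2, ∑ k : Fin 2, ‖(conjR (V x μ) (φZ (x + unitVec μ)) - φZ x) j k‖ ^ 2 else 0) := by
      refine Finset.sum_le_sum fun x _ => Finset.sum_le_sum fun μ _ => ?_
      split_ifs
      · exact MatrixNorms.opNorm_sq_le_sum_norm_sq _
      · exact le_rfl
    have hR0 : (0 : ℝ) ≤ R := by exact_mod_cast hR
    calc c₀ * ∑ w ∈ box z R, (eta F n K) ^ 2 * ∑ j : Fin 2, ∑ k : Fin 2, ‖φZ w j k‖ ^ 2
        ≤ c₀ * ∑ w ∈ box z R, (eta F n K) ^ 2 * (2 * ‖φZ w‖ ^ 2) := by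
          refine mul_le_mul_of_nonneg_left (Finset.sum_le_sum fun w _ => ?_) hc₀.le
          exact mul_le_mul_of_nonneg_left (sum_norm_sq_le_two_mul_opNorm_sq _) (sq_nonneg _)
      _ = 2 * (eta F n K) ^ 2 * c₀ * ∑ w ∈ box z R, ‖φZ w‖ ^ 2 := by
          rw [← Finset.mul_sum, ← Finset.mul_sum]; ring
      _ ≤ 2 * (eta F n K) ^ 2 * c₀ * (4 * 2 * R * (2 * R + 1) *
            ∑ x ∈ box z R, ∑ μ, (if x + unitVec μ ∈ box z R then
              ∑ j : Fin 2, ∑ k : Fin 2, ‖(conjR (V x μ) (φZ (x + unitVec μ)) - φZ x) j k‖ ^ 2 else 0)) := by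
          refine mul_le_mul_of_nonneg_left (hPo.trans ?_) (by positivity)
          exact mul_le_mul_of_nonneg_left hOF (by positivity)
      _ = _ := by ring
  -- (h3) the source
  · have hinv : ∀ w, ∑ j : Fin 2, ∑ k : Fin 2, ‖(((eta F n K)⁻¹ • conjR (axialFn V (fun i => z i - R) w)⁻¹ m)) j k‖ ^ 2
        = ((eta F n K)⁻¹) ^ 2 * ∑ j : Fin 2, ∑ k : Fin 2, ‖m j k‖ ^ 2 := by
      intro w
      rw [sum_norm_sq_real_smul, MatrixNorms.sum_norm_sq_eq_re_trace, MatrixNorms.sum_norm_sq_eq_re_trace,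
        re_trace_conjR_conjR ((unitaryUnits _).inv_mem (hu w))]
    simp_rw [hinv]
    rw [Finset.sum_const, nsmul_eq_mul]
    have hcard : ((box z (R - 1)).card : ℝ) ≤ (box z R).card := by exact_mod_cast Finset.card_le_card (box_mono z (by linarith))
    have hS := hSrc
    simp_rw [← MatrixNorms.sum_norm_sq_eq_re_trace] at hS
    push_cast at hS
    have hm0 : 0 ≤ ∑ j : Fin 2, ∑ k : Fin 2, ‖m j k‖ ^ 2 := by positivity
    have hη2 : 0 ≤ ((eta F n K)⁻¹) ^ 2 := sq_nonneg _
    rw [hr]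
    calc c₀ * (((box z (R - 1)).card : ℝ) * (((eta F n K)⁻¹) ^ 2 * ∑ j : Fin 2, ∑ k : Fin 2, ‖m j k‖ ^ 2))
        ≤ c₀ * (((box z R).card : ℝ) * (((eta F n K)⁻¹) ^ 2 * ∑ j : Fin 2, ∑ k : Fin 2, ‖m j k‖ ^ 2)) := by
          exact mul_le_mul_of_nonneg_left (mul_le_mul_of_nonneg_right hcard (by positivity)) hc₀.le
      _ = c₀ * ((eta F n K)⁻¹) ^ 2 * (((box z R).card : ℝ) * ∑ j : Fin 2, ∑ k : Fin 2, ‖m j k‖ ^ 2) := by ring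
      _ ≤ c₀ * ((eta F n K)⁻¹) ^ 2 * (16 * ((F.P K).d : ℝ) ^ 3 * 2 * R ^ 2 * α ^ 2 *
            ∑ x ∈ box z R, ∑ μ, (if x + unitVec μ ∈ box z R then
              ∑ j : Fin 2, ∑ k : Fin 2, ‖((toL2 F K c₀).symm y ⟨transl c x, μ⟩ - (conjR (V x μ) (φZ (x + unitVec μ)) - φZ x)) j k‖ ^ 2 else 0)) := by
          exact mul_le_mul_of_nonneg_left hS (by positivity)
      _ = _ := by ring
  -- (h4) the residual row: (B1′) through the chart (`residual_row_frobenius` on (B8)'s rows for the pull-back `y_Z`)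
  · rw [hr]
    exact residual_row_frobenius hR hα V hVu hP hw4 hc₀.le (fun w μ => (toL2 F K c₀).symm y ⟨transl c w, μ⟩) φZ m hEL hSrc hPyth hPoinc

end Summit.QuantumFields.YangMills.Theorems.Prop7BoxLocalResidualMember

end
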